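import Summits.ABC.StewartYu.PadicTwoSetup
import Summits.ABC.StewartYu.PadicW80ParLEnvelope
import Summits.ABC.StewartYu.DescentSizesQ
import Literature.NumberTheory.Transcendental.Waldschmidt1980SizeHyp
import HarnessLib

/-!
# Cell abc-stewartyu, W80Two (x): the parameter record at `p = 2` (`ℓ := 1`, `Mcl := 1`), its envelope,
# and the height link

`Summits/ABC/StewartYu/PadicTwoRecord.lean` — cell `abc-stewartyu` (seat p3; route `PadicPrimesW80TwoThirds`,
crux `W80Two` stmt-ABC-19486; one plain `def` (a record-valued constructor) + theorems, no named fact).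
The inputs of `packs_exist_two` that do not depend on the descent: for a `2`-adic set-up `S` (lit's
`TwoSetup`) with `d ≥ 1`, sizes `1 ≤ Vⱼ ≤ Vmax`, `1 ≤ V_θ ≤ Vmax`, `1 ≤ W`,

* `TwoSetup.recordOf` — p1's `(log p)`-normalised record `PadicW80ParL S.d` instantiated at `p = 2` with
  `ℓ := 1`, `Mcl := 1` (HOME/p1/W80Two-numerics-scoping.md §1; p1's `q = 3` record `PadicW80Par3*` consists
  of definitions and theorems ON this structure), `Vm := Vmax`;
* `TwoSetup.recordOf_U_le` — the envelope `U ≤ 2·Cw(d+1)·((∏ Vⱼ)·V_θ)·(W + log 2Vmax)·log 2Vmax` (p1's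
  `PadicW80ParL.U_le_Cw'` read at `ℓ = 1`, `Mcl = 1`), i.e. the exponent of `TwoSetup.twoCoreBound_of_packs`
  with `C m = 2·Cw m`;
* `SetupQ.flat_sizeHyp_of_logHeight` (place-free) / `TwoSetup.sizeHyp_of_logHeight` — Waldschmidt's size
  hypotheses `SizeHyp V V_θ W` of the flattening from `h(αⱼ) ≤ Vⱼ`, `h(θ) ≤ V_θ`, `log max(3,|b|) ≤ W`
  (verbatim p2's `TwistSetup.sizeHyp_of_logHeight`, which is stated for the twisted set-up only).

Everything is [folklore].

## References
* [Waldschmidt1980] M. Waldschmidt, Acta Arith. 37 (1980), §3.1 (3.1) (p. 263), Prop. 3.8.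
* [Yu1990] K. Yu, Compositio Math. 74 (1990), Theorem 2.1 and (2.30).
-/

noncomputable section

open Finset Height
open Literature.NumberTheory.Transcendental
open Literature.NumberTheory.Transcendental.CW77 (hgt)

namespace Summit.ABC.StewartYu

namespace SetupQ

/-- **The height link of the flattening, place-free**: from `h(αⱼ) ≤ Vⱼ`, `h(θ) ≤ V_θ`,
`log max(3,|bⱼ|) ≤ W`, `log max(3,|b_θ|) ≤ W`, Waldschmidt's `SizeHyp V V_θ W` for `Q.flat`. [folklore] -/
theorem flat_sizeHyp_of_logHeight (Q : SetupQ) {V : Fin Q.d → ℝ} {Vθ W : ℝ}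
    (hV : ∀ j, logHeight₁ (Q.α j) ≤ V j) (hW : ∀ j, Real.log (max 3 (|Q.b j| : ℝ)) ≤ W)
    (hVθ : logHeight₁ Q.θ ≤ Vθ) (hWθ : Real.log (max 3 (|Q.bθ| : ℝ)) ≤ W) : Q.flat.SizeHyp V Vθ W := by
  have hexp : ∀ z : ℤ, Real.log (max 3 (|z| : ℝ)) ≤ W → |(z : ℝ)| ≤ Real.exp W := by
    intro z hz
    have h3 : (0 : ℝ) < max 3 (|z| : ℝ) := lt_max_of_lt_left (by norm_num)
    have := Real.exp_le_exp.mpr hz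
    rw [Real.exp_log h3] at this
    exact (le_max_right _ _).trans this
  have hHabs : ∀ q : ℚ, Real.log (hgt |q|) = logHeight₁ q := fun q => by
    rw [SetupQ.hgt_abs, CW77.log_hgt_eq_logHeight₁]
  have hl : ∀ q : ℚ, q ≠ 0 → |Real.log ((|q| : ℚ) : ℝ)| ≤ logHeight₁ q := fun q hq => by
    rw [Rat.cast_abs, ← CW77.log_hgt_eq_logHeight₁]; exact SetupQ.abs_log_abs_le_log_hgt hq
  exact
    { hH := fun j => by
        show Real.log (hgt |Q.α j|) ≤ V j
        rw [hHabs]; exact hV j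
      hl := fun j => by
        show |Real.log ((|Q.α j| : ℚ) : ℝ)| ≤ V j
        exact (hl _ (Q.α_ne j)).trans (hV j)
      hHθ := by
        show Real.log (hgt |Q.θ|) ≤ Vθ
        rw [hHabs]; exact hVθ
      hlθ := by
        show |Real.log ((|Q.θ| : ℚ) : ℝ)| ≤ Vθ
        exact (hl _ Q.θ_ne).trans hVθ
      hb := fun j => hexp _ (hW j)
      hbθ := hexp _ hWθ }

end SetupQ

namespace TwoSetup

variable (S : TwoSetup)

/-- **The height link** for the `2`-adic set-up (Waldschmidt's `SizeHyp` of the frame `S.toQ.flat`).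
[folklore] -/
theorem sizeHyp_of_logHeight {V : Fin S.d → ℝ} {Vθ W : ℝ} (hV : ∀ j, logHeight₁ (S.α j) ≤ V j)
    (hW : ∀ j, Real.log (max 3 (|S.b j| : ℝ)) ≤ W) (hVθ : logHeight₁ S.θ ≤ Vθ)
    (hWθ : Real.log (max 3 (|S.bθ| : ℝ)) ≤ W) : S.toQ.flat.SizeHyp V Vθ W :=
  S.toQ.flat_sizeHyp_of_logHeight hV hW hVθ hWθ

/-- **The parameter record of the `2`-adic machine** built from the data: p1's `PadicW80ParL S.d` with
`ℓ := 1`, `Mcl := 1`, `Vm := Vmax` (floors `1 ≤ Vⱼ`, `1 ≤ V_θ`, `1 ≤ W`; `d ≥ 1`). [folklore] -/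
def recordOf (V : Fin S.d → ℝ) (Vθ Vmax W : ℝ) (hd : 1 ≤ S.d) (hV1 : ∀ j, 1 ≤ V j) (hVθ1 : 1 ≤ Vθ)
    (hVm : ∀ j, V j ≤ Vmax) (hVθm : Vθ ≤ Vmax) (hW1 : 1 ≤ W) : PadicW80ParL S.d :=
  { V := V, Vm := Vmax, Vθ := Vθ, W := W, ℓ := 1, Mcl := 1
    hℓ := le_rfl, hVℓ := hV1, hVmax := hVm, hVθℓ := hVθ1, hVθmax := hVθm, hWℓ := hW1
    hMcl := le_rfl, hMclℓ := by rw [Real.log_one]; exact zero_le_one, hd := hd }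

/-- `(recordOf …).ℓ = 1`. [folklore] -/
theorem recordOf_ℓ (V : Fin S.d → ℝ) (Vθ Vmax W : ℝ) (hd : 1 ≤ S.d) (hV1 : ∀ j, 1 ≤ V j)
    (hVθ1 : 1 ≤ Vθ) (hVm : ∀ j, V j ≤ Vmax) (hVθm : Vθ ≤ Vmax) (hW1 : 1 ≤ W) :
    (S.recordOf V Vθ Vmax W hd hV1 hVθ1 hVm hVθm hW1).ℓ = 1 := rfl

/-- `(recordOf …).Mcl = 1`. [folklore] -/
theorem recordOf_Mcl (V : Fin S.d → ℝ) (Vθ Vmax W : ℝ) (hd : 1 ≤ S.d) (hV1 : ∀ j, 1 ≤ V j)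
    (hVθ1 : 1 ≤ Vθ) (hVm : ∀ j, V j ≤ Vmax) (hVθm : Vθ ≤ Vmax) (hW1 : 1 ≤ W) :
    (S.recordOf V Vθ Vmax W hd hV1 hVθ1 hVm hVθm hW1).Mcl = 1 := rfl

/-- **The envelope at `p = 2`**: `U ≤ 2·Cw(d+1)·((∏ Vⱼ)·V_θ)·(W + log 2Vmax)·log 2Vmax` for the record
`recordOf` (p1's `PadicW80ParL.U_le_Cw'` with `ℓ = 1`, `Mcl = 1`). [cite: Waldschmidt1980, Prop. 3.8]
[cite: Yu1990, Theorem 2.1] -/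
theorem recordOf_U_le (V : Fin S.d → ℝ) (Vθ Vmax W : ℝ) (hd : 1 ≤ S.d) (hV1 : ∀ j, 1 ≤ V j)
    (hVθ1 : 1 ≤ Vθ) (hVm : ∀ j, V j ≤ Vmax) (hVθm : Vθ ≤ Vmax) (hW1 : 1 ≤ W) :
    (S.recordOf V Vθ Vmax W hd hV1 hVθ1 hVm hVθm hW1).Uℓ ≤
      (2 * PadicW80Par.Cw (S.d + 1)) * ((∏ j, V j) * Vθ) * (W + Real.log (2 * Vmax)) *
        Real.log (2 * Vmax) := by
  set P := S.recordOf V Vθ Vmax W hd hV1 hVθ1 hVm hVθm hW1 with hP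
  have h := P.U_le_Cw'
  have e1 : (∏ j, P.nV j) * P.nVθ = (∏ j, V j) * Vθ := by
    have hn : ∀ j, P.nV j = V j := fun j => by
      show P.V j / P.ℓ = V j; rw [show P.ℓ = 1 from rfl, div_one]; rfl
    have hnθ : P.nVθ = Vθ := by show P.Vθ / P.ℓ = Vθ; rw [show P.ℓ = 1 from rfl, div_one]; rfl
    rw [prod_congr rfl fun j _ => hn j, hnθ]
  have e2 : P.Mcl = 1 := rfl
  have e3 : P.W = W := rfl
  have e4 : P.Vm = Vmax := rfl
  rw [e1, e2, e3, e4] at h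
  calc P.Uℓ ≤ _ := h
    _ = _ := by ring

end TwoSetup

end Summit.ABC.StewartYu

end
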